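import Literature.AnabelianGeometry.SemiGraphs.TemperedGroups
import Mathlib.CategoryTheory.Limits.Shapes.BinaryProducts
import Mathlib.Algebra.Group.Action.Sum
import HarnessLib

/-!
# Semi-graphs of anabelioids, §3: the structure of `B^temp(Π)` (connected objects, epimorphisms)

Mochizuki, *Semi-graphs of anabelioids*, Publ. RIMS **42** (2006), §3 p. 33 and Remark 3.1.5
p. 34 [cite: MochizukiSemiAnbd2006, Rmk 3.1.5 p.34]: "It is immediate from the definitions that
every temperoid is an almost totally epimorphic category of countably connected type" — with the
§0 dictionary (p. 6 / [FrdI] §0 p. 15: nonempty = non-initial, connected = not a coproduct of two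
nonempty objects, almost totally epimorphic = arrows from nonempty to connected objects are
epimorphisms).  This proof-only file records, for the category `B^temp(Π)` of countable discrete
continuous `Π`-sets (`Literature.AnabelianGeometry.SemiGraphs.BTemp`), the three structural facts
these sentences rest on, in the tree's vocabulary:

* `BTemp.isNonemptyObj_iff` — an object is nonempty (non-initial) iff its underlying set is;
* `BTemp.isConnectedObj_iff` — an object is connected iff its underlying `Π`-set is nonempty and
  transitive (a binary coproduct in `B^temp(Π)` maps onto the disjoint union of the summands);
* `BTemp.epi_iff_surjective` — a morphism is an epimorphism iff it is surjective (test object: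
  the two-point trivial `Π`-set), whence `BTemp.epi_of_isConnectedObj`: every morphism from a
  nonempty object to a connected object is an epimorphism (the "almost totally epimorphic" clause
  of Remark 3.1.5 for `B^temp(Π)`).

Proof-only: no definitions; consumers: Proposition 3.2 / 3.6, Theorem 3.7, Remark 3.1.5.
-/

namespace Literature.AnabelianGeometry.SemiGraphs

open CategoryTheory CategoryTheory.Limits Topology
open Literature.AlgebraicGeometry.Frobenioids (IsConnectedObj IsNonemptyObj)

universe u

variable {G : Type u} [Group G] [TopologicalSpace G]

/-- Equivariance of a morphism of `B^temp(Π)`, pointwise. [folklore] -/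
private theorem hom_ρ {X Y : BTemp G} (f : X ⟶ Y) (g : G) (x : X.obj.V) :
    f.hom.hom (X.obj.ρ g x) = Y.obj.ρ g (f.hom.hom x) := by
  have e := ConcreteCategory.congr_hom (f.hom.comm g) x
  simp only [types_comp_apply] at e
  exact e

/-- An object of `B^temp(Π)` with empty underlying set is initial. [folklore] -/
private theorem isInitial_of_isEmpty (T : BTemp G) (h : IsEmpty T.obj.V) :
    Nonempty (IsInitial T) :=
  ⟨IsInitial.ofUniqueHom
    (fun _ => ObjectProperty.homMk
      { hom := TypeCat.ofHom fun x => h.elim x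
        comm := fun _ => ConcreteCategory.hom_ext _ _ fun x => h.elim x })
    fun _ _ => ObjectProperty.hom_ext _
      (Action.hom_ext _ _ (ConcreteCategory.hom_ext _ _ fun x => h.elim x))⟩

/-- **`B^temp(Π)`: nonempty objects** ([SemiAnbd] §3 / §0 dictionary): an object of `B^temp(Π)` is
nonempty in the categorical sense (not an initial object) iff its underlying set is nonempty.
[cite: MochizukiSemiAnbd2006, Rmk 3.1.5 p.34] -/
theorem BTemp.isNonemptyObj_iff (T : BTemp G) : IsNonemptyObj T ↔ Nonempty T.obj.V := by
  constructor
  · intro h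
    by_contra hne
    rw [not_nonempty_iff] at hne
    obtain ⟨hI⟩ := isInitial_of_isEmpty T hne
    exact h.false hI
  · rintro ⟨x⟩
    constructor
    intro hI
    let E : BTemp G := ⟨{ V := PEmpty.{u + 1}, ρ := 1 }, ⟨inferInstance, fun z => z.elim⟩⟩
    exact ((hI.to E).hom.hom x : PEmpty).elim

/-- **`B^temp(Π)`: epimorphisms are the surjections** (test object: the two-point `Π`-set with
trivial action, which lies in `B^temp(Π)`). [cite: MochizukiSemiAnbd2006, Rmk 3.1.5 p.34] -/
theorem BTemp.epi_iff_surjective {X Y : BTemp G} (f : X ⟶ Y) :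
    Epi f ↔ Function.Surjective fun x : X.obj.V => (f.hom.hom x : Y.obj.V) := by
  classical
  constructor
  · intro hf y
    by_contra hy
    -- the two-point trivial `Π`-set and the two test maps
    let Ω : BTemp G := ⟨{ V := ULift.{u} Bool, ρ := 1 }, ⟨inferInstance, fun z => by
      have : {g : G | ((1 : G →* End (ULift.{u} Bool)) g) z = z} = Set.univ :=
        Set.eq_univ_of_forall fun _ => rfl
      exact (congrArg IsOpen this).mpr isOpen_univ⟩⟩
    have hstable : ∀ (g : G) (z : Y.obj.V), (∃ x, f.hom.hom x = Y.obj.ρ g z) ↔ ∃ x, f.hom.hom x = z := by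
      intro g z
      constructor
      · rintro ⟨x, hx⟩
        refine ⟨X.obj.ρ g⁻¹ x, ?_⟩
        rw [hom_ρ, hx]
        exact Action.ρ_inv_self_apply g z
      · rintro ⟨x, hx⟩
        exact ⟨X.obj.ρ g x, by rw [hom_ρ, hx]⟩
    let χ : Y ⟶ Ω := ObjectProperty.homMk
      { hom := TypeCat.ofHom fun z => ULift.up (decide (∃ x, f.hom.hom x = z))
        comm := fun g => by
          apply ConcreteCategory.hom_ext
          intro z
          simp only [types_comp_apply, TypeCat.ofHom_apply]
          change ULift.up (decide (∃ x, f.hom.hom x = Y.obj.ρ g z)) =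
            (1 : G →* End (ULift.{u} Bool)) g (ULift.up (decide (∃ x, f.hom.hom x = z)))
          rw [MonoidHom.one_apply, decide_eq_decide.mpr (hstable g z)]
          rfl }
    let κ : Y ⟶ Ω := ObjectProperty.homMk
      { hom := TypeCat.ofHom fun _ => ULift.up true
        comm := fun g => by
          apply ConcreteCategory.hom_ext
          intro z
          rfl }
    have hχκ : f ≫ χ = f ≫ κ := by
      apply ObjectProperty.hom_ext
      apply Action.hom_ext
      apply ConcreteCategory.hom_ext
      intro x
      change ULift.up (decide (∃ x', f.hom.hom x' = f.hom.hom x)) = ULift.up true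
      rw [decide_eq_true ⟨x, rfl⟩]
    have h := congrArg (fun φ : Y ⟶ Ω => (φ.hom.hom y : ULift.{u} Bool)) (hf.left_cancellation _ _ hχκ)
    change ULift.up (decide (∃ x, f.hom.hom x = y)) = ULift.up true at h
    exact hy (of_decide_eq_true (ULift.up_inj.mp h))
  · intro hf
    constructor
    intro Z g h e
    apply ObjectProperty.hom_ext
    apply Action.hom_ext
    apply ConcreteCategory.hom_ext
    intro y
    obtain ⟨x, rfl⟩ := hf y
    exact congrArg (fun φ : X ⟶ Z => (φ.hom.hom x : Z.obj.V)) e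

/-- **`B^temp(Π)`: connected objects are the transitive nonempty `Π`-sets**.  (⇒): otherwise the
object is the coproduct, in `B^temp(Π)`, of an orbit and its complement; (⇐): a colimit binary
cofan with nonempty legs maps equivariantly onto the disjoint union of the legs, separating two
points of one orbit. [cite: MochizukiSemiAnbd2006, Rmk 3.1.5 p.34] -/
theorem BTemp.isConnectedObj_iff (T : BTemp G) :
    IsConnectedObj T ↔ Nonempty T.obj.V ∧ ∀ x y : T.obj.V, ∃ g : G, T.obj.ρ g x = y := by
  classical
  letI : MulAction G T.obj.V := Action.instMulAction T.obj
  constructor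
  · intro hT
    refine ⟨(BTemp.isNonemptyObj_iff T).mp hT.1, fun x₀ x => ?_⟩
    by_contra hx
    -- sub-`Π`-sets as objects of `B^temp(Π)`, with their inclusions
    let B : SubMulAction G T.obj.V → BTemp G := fun S =>
      ⟨{ V := S, ρ := (Action.ofMulAction G S).ρ }, by
        haveI : Countable T.obj.V := T.property.1
        refine ⟨inferInstanceAs (Countable S), fun (y : S) => ?_⟩
        change IsOpen {g : G | (Action.ofMulAction G S).ρ g y = y}
        have : {g : G | (Action.ofMulAction G S).ρ g y = y} = {g : G | T.obj.ρ g y.1 = y.1} := by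
          ext g
          simp only [Set.mem_setOf_eq]
          change g • y = y ↔ g • (y.1 : T.obj.V) = y.1
          rw [Subtype.ext_iff, SubMulAction.val_smul]
        rw [this]
        exact T.property.2 y.1⟩
    let ι : ∀ S : SubMulAction G T.obj.V, B S ⟶ T := fun S =>
      ObjectProperty.homMk
        { hom := TypeCat.ofHom fun y : S => (y.1 : T.obj.V)
          comm := fun _ => by
            apply ConcreteCategory.hom_ext
            intro y
            rfl }
    have hne : ∀ (S : SubMulAction G T.obj.V) (_ : S), IsNonemptyObj (B S) := fun S y =>
      (BTemp.isNonemptyObj_iff (B S)).mpr ⟨y⟩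
    -- the orbit of `x₀` and its complement
    let S : SubMulAction G T.obj.V :=
      { carrier := MulAction.orbit G x₀
        smul_mem' := fun g {_} hy => MulAction.mem_orbit_of_mem_orbit g hy }
    let Sc : SubMulAction G T.obj.V :=
      { carrier := (S : Set T.obj.V)ᶜ
        smul_mem' := fun g {y} hy => by
          intro hgy
          apply hy
          have := S.smul_mem g⁻¹ hgy
          rwa [inv_smul_smul] at this }
    have hx' : x ∈ Sc := fun ⟨g, hg⟩ => hx ⟨g, hg⟩
    -- `T = S ⊔ Sc` in `B^temp(Π)`
    let d : ∀ s : BinaryCofan (B S) (B Sc), T.obj.V → s.pt.obj.V := fun s y =>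
      if hy : y ∈ S then s.inl.hom.hom (⟨y, hy⟩ : S) else s.inr.hom.hom (⟨y, hy⟩ : Sc)
    have hd₁ : ∀ s y (hy : y ∈ S), d s y = s.inl.hom.hom (⟨y, hy⟩ : S) := fun s y hy => by
      simp only [d, dif_pos hy]
    have hd₂ : ∀ s y (hy : y ∉ S), d s y = s.inr.hom.hom (⟨y, hy⟩ : Sc) := fun s y hy => by
      simp only [d, dif_neg hy]
    have hcol : Nonempty (IsColimit (BinaryCofan.mk (ι S) (ι Sc))) := by
      refine ⟨BinaryCofan.isColimitMk
        (fun s => ObjectProperty.homMk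
          { hom := TypeCat.ofHom (d s)
            comm := fun g => ?_ }) ?_ ?_ ?_⟩
      · apply ConcreteCategory.hom_ext
        intro y
        change d s (g • y) = s.pt.obj.ρ g (d s y)
        by_cases hy : y ∈ S
        · rw [hd₁ s y hy, hd₁ s (g • y) (S.smul_mem g hy)]
          exact ConcreteCategory.congr_hom (s.inl.hom.comm g) (⟨y, hy⟩ : S)
        · rw [hd₂ s y hy, hd₂ s (g • y) (Sc.smul_mem g hy)]
          exact ConcreteCategory.congr_hom (s.inr.hom.comm g) (⟨y, hy⟩ : Sc)
      · intro s
        apply ObjectProperty.hom_ext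
        apply Action.hom_ext
        apply ConcreteCategory.hom_ext
        intro y
        change d s (y.1 : T.obj.V) = s.inl.hom.hom y
        rw [hd₁ s y.1 y.2]
      · intro s
        apply ObjectProperty.hom_ext
        apply Action.hom_ext
        apply ConcreteCategory.hom_ext
        intro y
        change d s (y.1 : T.obj.V) = s.inr.hom.hom y
        rw [hd₂ s y.1 y.2]
      · intro s m h₁ h₂
        apply ObjectProperty.hom_ext
        apply Action.hom_ext
        apply ConcreteCategory.hom_ext
        intro y
        change m.hom.hom y = d s y
        by_cases hy : y ∈ S
        · rw [hd₁ s y hy, ← h₁]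
          rfl
        · rw [hd₂ s y hy, ← h₂]
          rfl
    have h := hT.2 _ _ (ι S) (ι Sc) (hne S ⟨x₀, MulAction.mem_orbit_self x₀⟩) (hne Sc ⟨x, hx'⟩)
    exact h.false hcol.some
  · rintro ⟨hne, htrans⟩
    refine ⟨(BTemp.isNonemptyObj_iff T).mpr hne, fun B₁ B₂ ι₁ ι₂ h₁ h₂ => ⟨fun hc => ?_⟩⟩
    obtain ⟨b₁⟩ := (BTemp.isNonemptyObj_iff B₁).mp h₁
    obtain ⟨b₂⟩ := (BTemp.isNonemptyObj_iff B₂).mp h₂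
    -- the disjoint union of the legs, an object of `B^temp(Π)`, and the comparison map
    letI i₁ : MulAction G B₁.obj.V := Action.instMulAction B₁.obj
    letI i₂ : MulAction G B₂.obj.V := Action.instMulAction B₂.obj
    let W : BTemp G :=
      ⟨{ V := B₁.obj.V ⊕ B₂.obj.V
         ρ := (Action.ofMulAction G (B₁.obj.V ⊕ B₂.obj.V)).ρ }, by
        haveI : Countable B₁.obj.V := B₁.property.1
        haveI : Countable B₂.obj.V := B₂.property.1
        refine ⟨inferInstanceAs (Countable (B₁.obj.V ⊕ B₂.obj.V)), fun z => ?_⟩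
        change IsOpen {g : G | (Action.ofMulAction G (B₁.obj.V ⊕ B₂.obj.V)).ρ g z = z}
        rcases z with b | b
        · have : {g : G | (Action.ofMulAction G (B₁.obj.V ⊕ B₂.obj.V)).ρ g (Sum.inl b) = Sum.inl b}
              = {g : G | B₁.obj.ρ g b = b} := by
            ext g
            simp only [Set.mem_setOf_eq]
            change (Sum.inl (g • b) : B₁.obj.V ⊕ B₂.obj.V) = Sum.inl b ↔ _
            rw [Sum.inl.injEq]
            rfl
          rw [this]
          exact B₁.property.2 b
        · have : {g : G | (Action.ofMulAction G (B₁.obj.V ⊕ B₂.obj.V)).ρ g (Sum.inr b) = Sum.inr b}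
              = {g : G | B₂.obj.ρ g b = b} := by
            ext g
            simp only [Set.mem_setOf_eq]
            change (Sum.inr (g • b) : B₁.obj.V ⊕ B₂.obj.V) = Sum.inr b ↔ _
            rw [Sum.inr.injEq]
            rfl
          rw [this]
          exact B₂.property.2 b⟩
    let j₁ : B₁ ⟶ W := ObjectProperty.homMk
      { hom := TypeCat.ofHom fun b : B₁.obj.V => (Sum.inl b : B₁.obj.V ⊕ B₂.obj.V)
        comm := fun _ => by
          apply ConcreteCategory.hom_ext
          intro b
          rfl }
    let j₂ : B₂ ⟶ W := ObjectProperty.homMk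
      { hom := TypeCat.ofHom fun b : B₂.obj.V => (Sum.inr b : B₁.obj.V ⊕ B₂.obj.V)
        comm := fun _ => by
          apply ConcreteCategory.hom_ext
          intro b
          rfl }
    let desc : T ⟶ W := hc.desc (BinaryCofan.mk j₁ j₂)
    have hdesc₁ : ι₁ ≫ desc = j₁ := hc.fac (BinaryCofan.mk j₁ j₂) ⟨WalkingPair.left⟩
    have hdesc₂ : ι₂ ≫ desc = j₂ := hc.fac (BinaryCofan.mk j₁ j₂) ⟨WalkingPair.right⟩
    -- two points of one orbit land in different summands
    obtain ⟨g, hg⟩ := htrans (ι₁.hom.hom b₁) (ι₂.hom.hom b₂)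
    have e₁ : (desc.hom.hom (ι₁.hom.hom b₁) : B₁.obj.V ⊕ B₂.obj.V) = Sum.inl b₁ :=
      congrArg (fun φ : B₁ ⟶ W => (φ.hom.hom b₁ : B₁.obj.V ⊕ B₂.obj.V)) hdesc₁
    have e₂ : (desc.hom.hom (ι₂.hom.hom b₂) : B₁.obj.V ⊕ B₂.obj.V) = Sum.inr b₂ :=
      congrArg (fun φ : B₂ ⟶ W => (φ.hom.hom b₂ : B₁.obj.V ⊕ B₂.obj.V)) hdesc₂
    have e₃ : (desc.hom.hom (T.obj.ρ g (ι₁.hom.hom b₁)) : B₁.obj.V ⊕ B₂.obj.V) =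
        W.obj.ρ g (desc.hom.hom (ι₁.hom.hom b₁)) := hom_ρ desc g _
    rw [hg, e₂, e₁] at e₃
    exact Sum.inr_ne_inl e₃

/-- **`B^temp(Π)` is almost totally epimorphic** (the first clause of [SemiAnbd] Remark 3.1.5 for
`B^temp(Π)`): a morphism from a nonempty object to a transitive object is surjective, hence an
epimorphism. [cite: MochizukiSemiAnbd2006, Rmk 3.1.5 p.34] -/
theorem BTemp.epi_of_transitive {X Y : BTemp G} (f : X ⟶ Y) (hX : Nonempty X.obj.V)
    (hY : ∀ x y : Y.obj.V, ∃ g : G, Y.obj.ρ g x = y) : Epi f := by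
  rw [BTemp.epi_iff_surjective]
  intro y
  obtain ⟨x⟩ := hX
  obtain ⟨g, hg⟩ := hY (f.hom.hom x) y
  exact ⟨X.obj.ρ g x, (hom_ρ f g x).trans hg⟩

/-- **`B^temp(Π)` is almost totally epimorphic** ([SemiAnbd] Remark 3.1.5, first clause, for
`B^temp(Π)`): every morphism from a nonempty object to a connected object is an epimorphism.
[cite: MochizukiSemiAnbd2006, Rmk 3.1.5 p.34] -/
theorem BTemp.epi_of_isConnectedObj {X Y : BTemp G} (f : X ⟶ Y) (hX : IsNonemptyObj X)
    (hY : IsConnectedObj Y) : Epi f :=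
  BTemp.epi_of_transitive f ((BTemp.isNonemptyObj_iff X).mp hX) ((BTemp.isConnectedObj_iff Y).mp hY).2

/-! ### Monomorphisms (appended) -/

/-- **`B^temp(Π)`: monomorphisms are the injections** (test object: the equivariant kernel pair
`{(a, b) | f a = f b} ⊆ X × X`, a countable `Π`-set with open stabilisers).
[cite: MochizukiSemiAnbd2006, Rmk 3.1.5 p.34] -/
theorem BTemp.mono_iff_injective {X Y : BTemp G} (f : X ⟶ Y) :
    Mono f ↔ Function.Injective fun x : X.obj.V => (f.hom.hom x : Y.obj.V) := by
  constructor
  · intro hf a b hab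
    letI : MulAction G X.obj.V := Action.instMulAction X.obj
    -- the kernel pair of `f` as an object of `B^temp(Π)`
    let K : SubMulAction G (X.obj.V × X.obj.V) :=
      { carrier := {q | (f.hom.hom q.1 : Y.obj.V) = f.hom.hom q.2}
        smul_mem' := fun g {q} hq => by
          change (f.hom.hom (X.obj.ρ g q.1) : Y.obj.V) = f.hom.hom (X.obj.ρ g q.2)
          rw [hom_ρ, hom_ρ]
          exact congrArg (fun y => (Y.obj.ρ g y : Y.obj.V)) hq }
    let Z : BTemp G := ⟨{ V := K, ρ := (Action.ofMulAction G K).ρ }, by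
      haveI : Countable X.obj.V := X.property.1
      refine ⟨inferInstanceAs (Countable K), fun (q : K) => ?_⟩
      change IsOpen {g : G | (Action.ofMulAction G K).ρ g q = q}
      have : {g : G | (Action.ofMulAction G K).ρ g q = q} =
          {g : G | X.obj.ρ g q.1.1 = q.1.1} ∩ {g : G | X.obj.ρ g q.1.2 = q.1.2} := by
        ext g
        simp only [Set.mem_setOf_eq, Set.mem_inter_iff]
        change g • q = q ↔ g • q.1.1 = q.1.1 ∧ g • q.1.2 = q.1.2
        rw [Subtype.ext_iff, SubMulAction.val_smul, Prod.ext_iff]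
        rfl
      rw [this]
      exact (X.property.2 q.1.1).inter (X.property.2 q.1.2)⟩
    let p₁ : Z ⟶ X := ObjectProperty.homMk
      { hom := TypeCat.ofHom fun q : K => (q.1.1 : X.obj.V)
        comm := fun _ => by
          apply ConcreteCategory.hom_ext
          intro q
          rfl }
    let p₂ : Z ⟶ X := ObjectProperty.homMk
      { hom := TypeCat.ofHom fun q : K => (q.1.2 : X.obj.V)
        comm := fun _ => by
          apply ConcreteCategory.hom_ext
          intro q
          rfl }
    have h : p₁ ≫ f = p₂ ≫ f := by
      apply ObjectProperty.hom_ext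
      apply Action.hom_ext
      apply ConcreteCategory.hom_ext
      intro q
      exact q.2
    have hp := hf.right_cancellation p₁ p₂ h
    exact congrArg (fun φ : Z ⟶ X => (φ.hom.hom (⟨(a, b), hab⟩ : K) : X.obj.V)) hp
  · intro hf
    constructor
    intro Z g h e
    apply ObjectProperty.hom_ext
    apply Action.hom_ext
    apply ConcreteCategory.hom_ext
    intro z
    exact hf (congrArg (fun φ : Z ⟶ Y => (φ.hom.hom z : Y.obj.V)) e)

end Literature.AnabelianGeometry.SemiGraphs
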